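import Mathlib
import Summits.NavierStokesRegularity.NavierStokesRegularity.Theorems.EulerZoomLiouvillePowerGaugeEulerLiouvilleSelfSimilarKelvinFlowC2
import Literature.Analysis.FluidPDE.HarmonicLiouvilleSublinear
import HarnessLib.Audit

/-!
# Rung C1 of the crux `EulerZoomLiouville.PowerGaugeEulerLiouville` (sub-stratum W3b, tools): BARRIER CONFINEMENT OF BACKWARD
# SIMILARITY ORBITS, the cutoff without a global bound, and Liouville for irrotational incompressible fields of sublinear growth

Route №10 `EulerZoomLiouville` (NavierStokesRegularity), crux E = stmt-NavierStokesRegularity-19832, tenure rung C1,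
registered residue `stub_selfSimilarExtremalRest`, sub-stratum W3b («`C²` profiles UNBOUNDED at infinity»).  Lineage
ns-typeII-p1 (gen 8).  Tools for the companion `…SelfSimilarSublinearLoc` (`Loc.eq_const_of_sublinear`: a `C²` self-similar
Euler profile with `0 < γ < ½` and `U(y) = o(|y|)` is constant), which re-runs ns-typeII-p2 g8's cutoff localisation
(`…SelfSimilarBoundedLoc`) with the one use of `‖U‖ ≤ M` — backward confinement `‖Φ_s x‖ ≤ ‖x‖ + M/γ` — replaced by a barrier:

* `exists_cutoff_local` — `U ∈ C²`, `R > 0` ⇒ a `C²` field `Ṽ = χU` with `‖Ṽ‖ ≤ M` (some `M`), `‖DṼ‖ ≤ K`, `‖Ṽ y‖ ≤ ‖U y‖`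
  everywhere and `Ṽ = U` on `ball 0 R` (no bound on `U` needed: `χU` has compact support);
* `norm_flow_le_max_of_nonpos` — **barrier confinement**: `Ṽ ∈ C¹`, `‖DṼ‖ ≤ K`, `‖Ṽ y‖ ≤ (γ/2)‖y‖` for `‖y‖ ≥ R > 0`,
  `γ > 0` ⇒ `‖Φ_s x‖ ≤ max ‖x‖ R` for all `s ≤ 0` (outside the ball `R`, `d/ds ‖Φ_s x‖² = 2γ‖Y‖² + 2⟪Y, ṼY⟫ ≥ γ‖Y‖² > 0`,
  so `t ↦ ‖Φ_{−t}x‖²` never crosses the level `(max ‖x‖ R)²` upwards — fencing lemma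
  `image_le_of_deriv_right_lt_deriv_boundary'`; no bound on `Ṽ`, no profile equation);
* `eq_const_of_curl_eq_zero_of_sublinear` — a `C²` field on `ℝ³` with `curl V = 0`, `div V = 0` and
  `V(y) = o(|y|)` (`∀ δ > 0, ∃ R, ∀ y, R ≤ ‖y‖ → ‖V y‖ ≤ δ‖y‖`) is constant (components are harmonic of sublinear growth:
  the tree's `HarmonicOnNhd.apply_eq_apply_of_sublinear`); `sublinear_of_bounded` — bounded ⇒ `o(|y|)`.

WHAT THIS IS NOT: not NS, not E, not rung C1 — Lagrangian / harmonic bookkeeping. [folklore; GilbargTrudinger2001 Thm 2.1;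
ConstantinIgnatovaVicol2026Putative §3.4.1 (3.21) (setting)]
-/

noncomputable section

-- flat `Theorems/<Route><Decl>…` files of one crux share the namespace of the crux (tree convention)
set_option linter.dupNamespace false

open MeasureTheory Set Filter Topology Metric Function InnerProductSpace
open scoped RealInnerProductSpace NNReal ENNReal ContDiff Laplacian

namespace Summit.NavierStokesRegularity.NavierStokesRegularity.Theorems.PowerGaugeEulerLiouville.Loc

open Literature.Analysis Literature.Analysis.FluidPDE
open Summit.NavierStokesRegularity.NavierStokesRegularity.Theorems.PowerGaugeEulerLiouville.Kelvin

variable {γ : ℝ} {U : EuclideanSpace ℝ (Fin 3) → EuclideanSpace ℝ (Fin 3)}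

/-! ### The cutoff (no bound on `U` needed) -/

/-- **Cutoff without a global bound**: a `C²` field `U` agrees on `ball 0 R` with a `C²` field `Ṽ = χ U` that is BOUNDED, has
GLOBALLY bounded gradient, and satisfies `‖Ṽ y‖ ≤ ‖U y‖` everywhere (`χ` a smooth bump, `= 1` on `closedBall 0 R`, supported in
`ball 0 (R+1)`, `0 ≤ χ ≤ 1`). [folklore] -/
theorem exists_cutoff_local (hU : ContDiff ℝ 2 U) {R : ℝ} (hR : 0 < R) :
    ∃ V : EuclideanSpace ℝ (Fin 3) → EuclideanSpace ℝ (Fin 3), ContDiff ℝ 2 V ∧ (∃ M : ℝ, ∀ y, ‖V y‖ ≤ M) ∧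
      (∀ y, ‖V y‖ ≤ ‖U y‖) ∧ (∃ K : ℝ, ∀ y, ‖fderiv ℝ V y‖ ≤ K) ∧
      ∀ y ∈ ball (0 : EuclideanSpace ℝ (Fin 3)) R, V y = U y := by
  let χ : ContDiffBump (0 : EuclideanSpace ℝ (Fin 3)) := ⟨R, R + 1, hR, by linarith⟩
  set V : EuclideanSpace ℝ (Fin 3) → EuclideanSpace ℝ (Fin 3) := fun y => χ y • U y with hVdef
  have hV : ContDiff ℝ 2 V := (χ.contDiff (n := 2)).smul hU
  -- `V` vanishes identically near every point outside `closedBall 0 (R+1)`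
  have hzero : ∀ y : EuclideanSpace ℝ (Fin 3), R + 1 < ‖y‖ → V =ᶠ[𝓝 y] fun _ => 0 := by
    intro y hy
    have hopen : IsOpen {y' : EuclideanSpace ℝ (Fin 3) | R + 1 < ‖y'‖} := isOpen_lt continuous_const continuous_norm
    filter_upwards [hopen.mem_nhds hy] with y' hy'
    have hns : y' ∉ Function.support (χ : EuclideanSpace ℝ (Fin 3) → ℝ) := by
      rw [χ.support_eq, mem_ball, dist_zero_right]
      exact not_lt.2 (le_of_lt hy')
    rw [Function.notMem_support] at hns
    simp [hVdef, hns]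
  refine ⟨V, hV, ?_, fun y => ?_, ?_, fun y hy => ?_⟩
  · obtain ⟨C, hC⟩ := (isCompact_closedBall (0 : EuclideanSpace ℝ (Fin 3)) (R + 2)).exists_bound_of_continuousOn
      hV.continuous.continuousOn
    refine ⟨max C 0, fun y => ?_⟩
    by_cases hy : ‖y‖ ≤ R + 2
    · exact (hC y (by rwa [mem_closedBall, dist_zero_right])).trans (le_max_left _ _)
    · push Not at hy
      rw [(hzero y (by linarith)).self_of_nhds, norm_zero]
      exact le_max_right _ _
  · rw [hVdef, norm_smul, Real.norm_of_nonneg χ.nonneg]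
    calc χ y * ‖U y‖ ≤ 1 * ‖U y‖ := mul_le_mul_of_nonneg_right χ.le_one (norm_nonneg _)
      _ = ‖U y‖ := one_mul _
  · have hDVc : Continuous (fderiv ℝ V) := hV.continuous_fderiv (by norm_num)
    obtain ⟨C, hC⟩ := (isCompact_closedBall (0 : EuclideanSpace ℝ (Fin 3)) (R + 2)).exists_bound_of_continuousOn
      hDVc.continuousOn
    refine ⟨max C 0, fun y => ?_⟩
    by_cases hy : ‖y‖ ≤ R + 2
    · exact (hC y (by rwa [mem_closedBall, dist_zero_right])).trans (le_max_left _ _)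
    · push Not at hy
      rw [(hzero y (by linarith)).fderiv_eq, fderiv_const_apply, norm_zero]
      exact le_max_right _ _
  · rw [mem_ball, dist_zero_right] at hy
    have h1 : χ y = 1 := χ.one_of_mem_closedBall (by rw [mem_closedBall, dist_zero_right]; exact hy.le)
    simp [hVdef, h1]

/-! ### Barrier confinement of backward similarity orbits -/

/-- **Barrier confinement**: for a `C¹` field `Ṽ` with `‖DṼ‖ ≤ K` and `‖Ṽ y‖ ≤ (γ/2)‖y‖` whenever `‖y‖ ≥ R` (`R > 0`,
`γ > 0`), every backward orbit of the similarity field `W = γy + Ṽ` satisfies `‖Φ_s x‖ ≤ max ‖x‖ R` for `s ≤ 0`: outside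
the ball of radius `R` one has `d/ds ‖Φ_s x‖² = 2γ‖Y‖² + 2⟪Y, Ṽ Y⟫ ≥ γ‖Y‖² > 0`, so `t ↦ ‖Φ_{−t} x‖²` cannot cross the level
`(max ‖x‖ R)²` upwards (fencing lemma). No bound on `Ṽ`, no profile equation. [folklore] -/
theorem norm_flow_le_max_of_nonpos {V : EuclideanSpace ℝ (Fin 3) → EuclideanSpace ℝ (Fin 3)} (hV : ContDiff ℝ 1 V)
    {K : ℝ} (hK : ∀ y, ‖fderiv ℝ V y‖ ≤ K) (hγ : 0 < γ) {R : ℝ} (hR : 0 < R)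
    (hfar : ∀ y, R ≤ ‖y‖ → ‖V y‖ ≤ γ / 2 * ‖y‖) (x : EuclideanSpace ℝ (Fin 3)) {s : ℝ} (hs : s ≤ 0) :
    ‖ODE.evolutionMap (fun _ : ℝ => selfSimilarTransport γ 0 V) 0 s x‖ ≤ max ‖x‖ R := by
  set Φ := ODE.evolutionMap (fun _ : ℝ => selfSimilarTransport γ 0 V) 0 with hΦ
  set m : ℝ := max ‖x‖ R with hm
  have hm0 : 0 < m := lt_max_of_lt_right hR
  -- `g t = ‖Φ_{−t} x‖²`, `g' t = 2⟪Y, −W(Y)⟫`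
  set g : ℝ → ℝ := fun t => ‖Φ (-t) x‖ ^ 2 with hg
  set g' : ℝ → ℝ := fun t => 2 * ⟪Φ (-t) x, (-1 : ℝ) • selfSimilarTransport γ 0 V (Φ (-t) x)⟫ with hg'
  have hder : ∀ t, HasDerivAt g (g' t) t := fun t =>
    (C2.Kelvin.hasDerivAt_flow_neg (γ := γ) hV hK x t).norm_sq
  have key : ∀ b : ℝ, ∀ ⦃t⦄, t ∈ Icc 0 b → g t ≤ m ^ 2 := by
    intro b
    refine image_le_of_deriv_right_lt_deriv_boundary' (f := g) (f' := g') (a := 0) (b := b)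
      (fun t _ => (hder t).continuousAt.continuousWithinAt) (fun t _ => (hder t).hasDerivWithinAt)
      (B := fun _ => m ^ 2) (B' := fun _ => 0) ?_ continuousOn_const (fun t _ => (hasDerivAt_const t _).hasDerivWithinAt) ?_
    · -- `g 0 = ‖x‖² ≤ m²`
      have h0 : g 0 = ‖x‖ ^ 2 := by simp [hg, hΦ, ODE.evolutionMap_self]
      rw [h0]
      exact pow_le_pow_left₀ (norm_nonneg _) (le_max_left _ _) 2
    · -- on the barrier the derivative is negative
      intro t _ hgt
      set Y := Φ (-t) x with hY
      have hYn : ‖Y‖ = m := by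
        have h1 : ‖Y‖ ^ 2 = m ^ 2 := hgt
        exact (pow_left_inj₀ (norm_nonneg Y) hm0.le two_ne_zero).1 h1
      have hRY : R ≤ ‖Y‖ := by rw [hYn]; exact le_max_right _ _
      have hVY : ‖V Y‖ ≤ γ / 2 * ‖Y‖ := hfar Y hRY
      have hinner : ⟪Y, V Y⟫ ≥ -(γ / 2 * ‖Y‖ * ‖Y‖) := by
        have h := abs_real_inner_le_norm Y (V Y)
        have h' : |⟪Y, V Y⟫| ≤ ‖Y‖ * (γ / 2 * ‖Y‖) := h.trans (mul_le_mul_of_nonneg_left hVY (norm_nonneg _))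
        have := neg_abs_le ⟪Y, V Y⟫
        nlinarith
      have hcalc : g' t = -(2 * γ * ‖Y‖ ^ 2) - 2 * ⟪Y, V Y⟫ := by
        simp only [hg', ← hY, selfSimilarTransport_apply, sub_zero, inner_smul_right, inner_add_right,
          real_inner_self_eq_norm_sq]
        ring
      rw [hcalc]
      have hm2 : 0 < ‖Y‖ ^ 2 := by rw [hYn]; positivity
      nlinarith
  have ht : -s ∈ Icc (0 : ℝ) (-s) := ⟨neg_nonneg.2 hs, le_rfl⟩
  have h := key (-s) ht
  simp only [hg, neg_neg] at h
  exact (pow_le_pow_iff_left₀ (norm_nonneg _) hm0.le two_ne_zero).1 h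

/-! ### Liouville: irrotational, incompressible, sublinear growth ⇒ constant -/

/-- **An irrotational incompressible `C²` field on `ℝ³` of sublinear growth is constant** (its components are harmonic
functions of sublinear growth: the tree's `HarmonicOnNhd.apply_eq_apply_of_sublinear`). [cite: GilbargTrudinger2001, Thm 2.1 (Liouville via mean values)] -/
theorem eq_const_of_curl_eq_zero_of_sublinear {V : EuclideanSpace ℝ (Fin 3) → EuclideanSpace ℝ (Fin 3)}
    (hV : ContDiff ℝ 2 V) (hcurl : ∀ x, curl V x = 0) (hdiv : VectorCalculus.IsDivFree V)
    (hsub : ∀ δ : ℝ, 0 < δ → ∃ R : ℝ, ∀ y : EuclideanSpace ℝ (Fin 3), R ≤ ‖y‖ → ‖V y‖ ≤ δ * ‖y‖)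
    (x y : EuclideanSpace ℝ (Fin 3)) : V x = V y := by
  have hΔ := laplacian_eq_zero_of_curl_eq_zero_of_isDivFree hV hcurl hdiv
  ext i
  set η : EuclideanSpace ℝ (Fin 3) → ℝ := fun z => V z i with hη
  have hηeq : η = (EuclideanSpace.proj i : EuclideanSpace ℝ (Fin 3) →L[ℝ] ℝ) ∘ V := by funext z; rfl
  have hη2 : ContDiff ℝ 2 η := by
    rw [hηeq]; exact (EuclideanSpace.proj i : EuclideanSpace ℝ (Fin 3) →L[ℝ] ℝ).contDiff.comp hV
  have hηΔ : ∀ z, (Δ η) z = 0 := fun z => by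
    rw [hηeq, hV.contDiffAt.laplacian_CLM_comp_left, Function.comp_apply, hΔ z, map_zero]
  have hharm : HarmonicOnNhd η univ := harmonicOnNhd_of_laplacian_eq_zero hη2 hηΔ
  have hgr : ∀ δ : ℝ, 0 < δ → ∃ Rδ : ℝ, ∀ z : EuclideanSpace ℝ (Fin 3), Rδ ≤ ‖z‖ → |η z| ≤ δ * ‖z‖ := by
    intro δ hδ
    obtain ⟨Rδ, hRδ⟩ := hsub δ hδ
    refine ⟨Rδ, fun z hz => le_trans ?_ (hRδ z hz)⟩
    simpa [hη, Real.norm_eq_abs] using PiLp.norm_apply_le (V z) i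
  exact hharm.apply_eq_apply_of_sublinear hgr x y

/-- Bounded fields have sublinear growth (so `eq_const_of_sublinear` contains `eq_const_of_bounded`). [folklore] -/
theorem sublinear_of_bounded {M : ℝ} (hM : ∀ y, ‖U y‖ ≤ M) :
    ∀ δ : ℝ, 0 < δ → ∃ R : ℝ, ∀ y : EuclideanSpace ℝ (Fin 3), R ≤ ‖y‖ → ‖U y‖ ≤ δ * ‖y‖ := by
  intro δ hδ
  refine ⟨M / δ, fun z hz => (hM z).trans ?_⟩
  rwa [div_le_iff₀ hδ, mul_comm] at hz

end Summit.NavierStokesRegularity.NavierStokesRegularity.Theorems.PowerGaugeEulerLiouville.Loc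

end
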